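import Mathlib
import HarnessLib
import Summits.Langlands.Statement
import Summits.Langlands.Langlands.Theses.DepthPrimeSplit
import Summits.Langlands.Langlands.Theorems.TransientLevelSplitLevelFiniteness
import Summits.Langlands.Langlands.Theorems.WeakFernSplitFernSpread
import Summits.Langlands.Langlands.Theorems.FernRankSplitExchange
import Summits.Langlands.Langlands.Theorems.FernRankSplitFernSpread
import Summits.Langlands.Langlands.Theorems.FernTransitSplitFernRank
import Literature.NumberTheory.GaloisRepresentations.CrystallineDeformationRing

/-!
# IsotypicCrystallineSplit — decomp-langlands lens-3 («one certified translation + split beneath»), gen 33, RESIDUAL MODE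

TARGET (by name): SST = `Summit.Langlands.Langlands.Theorems.FernTransit.SemistableRankBound` (tree p835291; the residual of gen 31's
EQUIV RANK ⟺ SST ∧ TRANSIT under FERN `Theses.DepthPrimeSplit.FernSpread` stmt-Langlands-25024).

THE ONE EQUIV (kernel WITH content, modulo NOTHING): SST ⟺ ISST := Frame(semistable above ℓ → C_w^iso → C_b), where C_w^iso is the NEW
language ISOTYPIC WEAK PRO-AUTOMORPHY: off ONE finite `S`, to every depth `r`, a weak `r`-approximant ALL OF WHOSE MEMBERS ARE RESIDUALLY
CONGRUENT TO ρ (coefficientwise `|c_i(ρ(Frob_v)) − c_i(π_j, v)| < 1` at every `v ∉ S`, with the family's own Satake data); the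
hypothesis H1 (residual automorphy) is DELETED (it follows).  Kernel = ISOTYPIC LOCALISATION (`localise`, new): in any weak
`r`-approximant off `S ⊇ Ram ρ` the residually-far members can be thrown away at NO cost in depth or level — member `j` far at a datum
`(v_j, σ_j, i_j)` is killed by the 𝒪-linear factor `E_j = b_j T_{(v_j,i_j)} − b_j a_j`, a UNIT at `c(ρ)` because Frobenius polynomials at
unramified places are integral and Frobenius-independent; `P · ∏_far E_j` is a relation of the whole family whenever `P` is one of the
near sub-family.  Dictionary: C_w^iso(ρ) ⟺ «ρ mod {|·|<r} is an 𝒪-algebra point of the LOCALISED Hecke algebra 𝕋(π_1 ⊕ … ⊕ π_k)_𝔪,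
𝔪 = 𝔪_ρ̄» — the local rings every R → 𝕋 engine (Taylor–Wiles–Kisin patching, Emerton's 𝕋(K^p)_𝔪, Breuil–Hellmann–Schraen's patched
eigenvariety X_p(ρ̄)) is about; before localisation 𝕋(F) is only semi-local.

THE SPLIT BENEATH (in the iso language; EXACT dial on Fontaine's monodromy operator N at the places above ℓ, a datum INVARIANT UNDER
EVERY FINITE BASE CHANGE — hence orthogonal by construction to gen 32's solvable-layer mechanism and to the residual-image / field /
signature dials of lenses 2, 4, 5): ISST ⟺ CRYS ∧ MONO with
  CRYS = `CrystallineIsotypicRank`  := Frame(crystalline above ℓ → C_w^iso → C_b),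
  MONO = `MonodromicIsotypicRank`   := Frame(semistable, NOT crystalline above ℓ → C_w^iso → C_b).
Hence SST ⟺ CRYS ∧ MONO (`sst_iff_cells`), FERN ⟺ HF ∧ CRYS ∧ MONO ∧ TRANSIT (`fernSpread_iff_four`), and the frames `closes_sst`,
`closes_rank`, `closes_target`, `closes_root` (eleven binders → `_root_.Langlands`) BY NAME through the tree's `FernTransit.closes_*`.

TAGS (memo.md §3 for the labelled evidence):
* ISST  — EQUIV (= SST, `sst_iff_isoSst`), not a piece.
* CRYS  — WEAKER than SST (exact restriction, `crys_of_sst`; probe CRYS ↛ SST fails to close) · root-implied (`cells_of_langlands`) ·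
          PRINT for GL₂/ℚ (Emerton 2011 Thm 1.2.4(1) + Kisin + Coleman families + g30 exchange) · ATTACKABLE-IDEA for n = 2 over totally
          real F with ℓ split (patching for GL₂(ℚ_ℓ), CEGGPS) · OPEN-CONJECTURE for polarized n ≥ 3 at l₀ = 0 (Breuil–Hellmann–Schraen
          2017: automorphic components of the trianguline variety; this CORRECTS the lineage tag «SST ATTACKABLE-mod-PRINT at l₀ = 0»,
          which holds for n = 2 only) · BARRIER l₀ > 0 (Calegari–Mazur, Gee–Newton).
* MONO  — WEAKER than SST (exact restriction, `mono_of_sst`) · root-implied · PRINT GL₂/ℚ (semistable ⊂ trianguline, Emerton 1.2.4(1))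
          · IDEA-NEEDED beyond (ℒ-invariant local–global compatibility in families: Ding) · BARRIER l₀ > 0 · NOT transportable into CRYS
          by any base change (N ≠ 0 is insensitive to finite extensions) — an honest irreducible cell.
WHY EACH PIECE IS STRICTLY WEAKER: CRYS and MONO are SST restricted to complementary, non-empty, base-change-stable classes of ρ; neither
is known to imply SST or the summit (probes), both are implied by SST.
WHY NOVEL: first LOCALISATION theorem of the lineage's currency (g29–g32 had only size/exchange, S-monotonicity, freezing): residual
isotypy of ALL members is free, so the currency now speaks about the LOCAL Hecke rings 𝕋_𝔪 of the literature; and the first cut of SST that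
no solvable base change can move.
CURRENCY BARRIER recorded (memo §5): member-predicate intermediates (slope-bounded, weight-confined, spherical-at-ℓ, embedding-dimension,
growth-rate) either collapse to C_b, are false on the cyclic toy `𝒪[y]/(y^k − ℓ^k)`, or are print-cheap with an SST-hard complement:
constant-coefficient weak approximation cannot see analytic loci finite over weight discs of radius < 1.
-/

namespace Summit.Langlands.Langlands.Theorems.FernIsotypic

open scoped NumberField
open Filter Field IsDedekindDomain
open Literature.NumberTheory.GaloisRepresentations Literature.NumberTheory.Automorphic Literature.NumberTheory.PAdicHodge
open Summit.Langlands.Langlands.Theorems.TransientLevel Summit.Langlands.Langlands.Theorems.WeakFern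
open Summit.Langlands.Langlands.Theorems.FernRank Summit.Langlands.Langlands.Theorems.FernTransit
open Summit.Langlands.Langlands.Theses

set_option linter.dupNamespace false
set_option linter.unusedVariables false

/-! ## 32. Vocabulary: residual nearness, isotypic approximants, C_w^iso, crystalline above ℓ -/

section Vocabulary

variable {K : Type} [Field K] [NumberField K] {n : ℕ} {ℓ : ℕ} [Fact ℓ.Prime]

/-- The Satake datum `α` (of some cuspidal `π`, at the places off `S`) is RESIDUALLY NEAR `ρ` off `S`: at every `v ∉ S`, every prime above
`v` and every arithmetic Frobenius there, the L-normalised Satake polynomial is coefficientwise congruent to `charpoly ρ(Frob)` modulo the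
maximal ideal of `𝒪_{ℚ̄_ℓ}` (radius `1`, strict) — «`π` is `ρ̄`-isotypic off `S`». -/
def IsNear (ι : PadicAlgCl ℓ ≃+* ℂ) (ρ : FramedGaloisRep K (PadicAlgCl ℓ) n) (S : Set (HeightOneSpectrum (𝓞 K)))
    (α : HeightOneSpectrum (𝓞 K) → Multiset ℂ) : Prop :=
  ∀ v : HeightOneSpectrum (𝓞 K), v ∉ S → ∀ 𝔓 ∈ v.primesAbove, ∀ σ : absoluteGaloisGroup K, IsArithFrobAt (𝓞 K) σ 𝔓 →
    ∀ i : ℕ, Valued.v ((FramedRep.charpoly ρ σ - arithFrobPolyOfSatake ι v.residueCard 1 (α v)).coeff i) < 1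

/-- An ISOTYPIC weak `r`-approximant of `ρ` off `S`: a weak `r`-approximant (tree `IsWeakApproximant`, VERBATIM) all of whose members are
residually near `ρ` off `S` with the family's own Satake data. -/
def IsIsotypicApproximant (hcpt : isCompact_glFiniteIntegralLevel n K) (ι : PadicAlgCl ℓ ≃+* ℂ) (ρ : FramedGaloisRep K (PadicAlgCl ℓ) n)
    (S : Set (HeightOneSpectrum (𝓞 K))) (r : NNReal) (k : ℕ) (π : Fin k → CuspidalAutomorphicRepData n K hcpt)
    (α : Fin k → HeightOneSpectrum (𝓞 K) → Multiset ℂ) : Prop :=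
  IsWeakApproximant hcpt ι ρ S r k π α ∧ ∀ j : Fin k, IsNear ι ρ S (α j)

/-- C_w^iso · ISOTYPICALLY WEAKLY PRO-AUTOMORPHIC (the NEW language): ONE finite `S` such that for every radius `r > 0` some finite
`ρ̄`-ISOTYPIC cuspidal family of tame level `S` weakly `r`-approximates `ρ` — `ρ mod {|·| < r}` is an `𝒪`-algebra point of the LOCALISED
Hecke algebra `𝕋(π_1 ⊕ … ⊕ π_k)_{𝔪_ρ̄}`. -/
def IsIsotypicallyWeaklyProAutomorphic (hcpt : isCompact_glFiniteIntegralLevel n K) (ι : PadicAlgCl ℓ ≃+* ℂ)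
    (ρ : FramedGaloisRep K (PadicAlgCl ℓ) n) : Prop :=
  ∃ S : Set (HeightOneSpectrum (𝓞 K)), S.Finite ∧ ∀ r : NNReal, 0 < r →
    ∃ (k : ℕ) (π : Fin k → CuspidalAutomorphicRepData n K hcpt) (α : Fin k → HeightOneSpectrum (𝓞 K) → Multiset ℂ),
      IsIsotypicApproximant hcpt ι ρ S r k π α

/-- `ρ` is CRYSTALLINE above ℓ: at every `v ∣ ℓ`, crystalline for Fontaine's PINNED datum (accepted `PstWeilDeligneData.IsCrystallineFramed`:
de Rham, attached Weil–Deligne representation unramified with `N = 0`) — the reading of the tree's `LevelOneDyadic.IsCrystallineAbove`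
VERBATIM (restated here to keep this module's import cone inside the lineage). -/
def IsCrystallineAbove (ρ : FramedGaloisRep K (PadicAlgCl ℓ) n) : Prop :=
  ∀ (v : HeightOneSpectrum (𝓞 K)) (hv : ((ℓ : ℕ) : 𝓞 K) ∈ v.asIdeal), (fontainePstAdicCompletion v ℓ hv).IsCrystallineFramed (ρ.toLocal v)

end Vocabulary

/-! ## 33. The items -/

/-- ISST · ISOTYPIC SEMISTABLE RANK · the EQUIV node (= SST, `sst_iff_isoSst`; NOT a piece): for an irreducible pinned-geometric `ρ`
semistable above ℓ, C_w^iso ⟹ C_b (H1 deleted: it follows from C_w^iso, `residual_of_isoWeakly`). -/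
def IsotypicSemistableRank : Prop :=
  Frame fun hcpt ι ρ => IsSemistableAbove ρ → IsIsotypicallyWeaklyProAutomorphic hcpt ι ρ → IsBoundedlyWeaklyProAutomorphic hcpt ι ρ

/-- CRYS · CRYSTALLINE ISOTYPIC RANK · crux rank 2 of the split (deciding) · WEAKER than SST (`crys_of_sst`; probe CRYS ↛ SST) · OPEN ·
PRINT GL₂/ℚ (Emerton 2011 Thm 1.2.4(1), Kisin, Coleman + exchange) · ATTACKABLE-IDEA n = 2 totally real ℓ-split (GL₂(ℚ_ℓ) patching) ·
OPEN-CONJECTURE polarized n ≥ 3, l₀ = 0 (Breuil–Hellmann–Schraen 2017) · BARRIER l₀ > 0.  For ρ CRYSTALLINE above ℓ: C_w^iso ⟹ C_b. -/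
def CrystallineIsotypicRank : Prop :=
  Frame fun hcpt ι ρ => IsCrystallineAbove ρ → IsIsotypicallyWeaklyProAutomorphic hcpt ι ρ → IsBoundedlyWeaklyProAutomorphic hcpt ι ρ

/-- MONO · MONODROMIC (SEMISTABLE, NON-CRYSTALLINE) ISOTYPIC RANK · crux rank 3 (the re-cut residual) · WEAKER than SST (`mono_of_sst`;
probe MONO ↛ SST) · OPEN · PRINT GL₂/ℚ (semistable ⊂ trianguline) · IDEA-NEEDED beyond ℚ / n ≥ 3 (ℒ-invariants in families) ·
BARRIER l₀ > 0 · NOT reachable from CRYS by base change (N is insensitive to finite extensions).  For ρ semistable but NOT crystalline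
above ℓ: C_w^iso ⟹ C_b. -/
def MonodromicIsotypicRank : Prop :=
  Frame fun hcpt ι ρ => IsSemistableAbove ρ → ¬ IsCrystallineAbove ρ →
    IsIsotypicallyWeaklyProAutomorphic hcpt ι ρ → IsBoundedlyWeaklyProAutomorphic hcpt ι ρ

/-! ## 34. Kernel: ISOTYPIC LOCALISATION (far members are free to discard) -/

section Kernel

variable {K : Type} [Field K] [NumberField K] {n : ℕ} {ℓ : ℕ} [Fact ℓ.Prime]
  {hcpt : isCompact_glFiniteIntegralLevel n K} {ι : PadicAlgCl ℓ ≃+* ℂ} {ρ : FramedGaloisRep K (PadicAlgCl ℓ) n}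

/-- **ISOTYPIC LOCALISATION.**  If a `k`-member cuspidal family weakly `r`-approximates `ρ` off `S` and `ρ` is unramified off `S`, then
the SUB-FAMILY of its residually near members is an isotypic weak `r`-approximant off the SAME `S` at the SAME depth.
Proof: a far member `j` has a bad datum (`v_j ∉ S`, Frobenius `σ_j`, index `i_j`) with `|c_{i_j}(ρ(σ_j)) − a_j| ≥ 1`, `a_j` its Satake
coefficient; with `b_j = 1` if `|a_j| ≤ 1` and `b_j = a_j⁻¹` otherwise, `E_j = b_j T_{(v_j,i_j)} − b_j a_j ∈ 𝒪[T]` kills member `j` and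
`|E_j(c(ρ))| = |b_j| |c_{i_j} − a_j| ≥ 1` for EVERY admissible Frobenius choice (unramified: tree
`FramedGaloisRep.IsUnramifiedAt.hasFrobCharpolyAt_charpoly`); if `P ∈ 𝒪[T]` is a relation of the near sub-family then `P · ∏_far E_j`
is a relation of the whole family, so `|P(c(ρ))| ≤ |P(c(ρ))| · ∏ |E_j(c(ρ))| < r`. -/
theorem localise {S : Set (HeightOneSpectrum (𝓞 K))} {r : NNReal} {k : ℕ} {π : Fin k → CuspidalAutomorphicRepData n K hcpt}
    {α : Fin k → HeightOneSpectrum (𝓞 K) → Multiset ℂ} (hw : IsWeakApproximant hcpt ι ρ S r k π α)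
    (hur : ∀ v : HeightOneSpectrum (𝓞 K), v ∉ S → ρ.IsUnramifiedAt v) :
    ∃ (k' : ℕ) (π' : Fin k' → CuspidalAutomorphicRepData n K hcpt) (α' : Fin k' → HeightOneSpectrum (𝓞 K) → Multiset ℂ),
      IsIsotypicApproximant hcpt ι ρ S r k' π' α' ∧ ∀ j' : Fin k', ∃ j : Fin k, π' j' = π j ∧ α' j' = α j := by
  classical
  -- the near sub-family, re-indexed by `Fin`
  let J : Finset (Fin k) := Finset.univ.filter fun j => IsNear ι ρ S (α j)
  let emb : Fin J.card → Fin k := fun j' => (J.equivFin.symm j').1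
  have hembJ : ∀ j', emb j' ∈ J := fun j' => (J.equivFin.symm j').2
  have hnear : ∀ j', IsNear ι ρ S (α (emb j')) := fun j' => (Finset.mem_filter.mp (hembJ j')).2
  have hsurj : ∀ j : Fin k, IsNear ι ρ S (α j) → ∃ j', emb j' = j := fun j hj =>
    ⟨J.equivFin ⟨j, Finset.mem_filter.mpr ⟨Finset.mem_univ j, hj⟩⟩, by simp [emb]⟩
  refine ⟨J.card, fun j' => π (emb j'), fun j' => α (emb j'), ⟨⟨fun j' => hw.1 (emb j'), fun Φ hΦ P' hP' => ?_⟩, hnear⟩,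
    fun j' => ⟨emb j', rfl, rfl⟩⟩
  -- a bad datum for every FAR member
  have H : ∀ j : {j : Fin k // ¬ IsNear ι ρ S (α j)}, ∃ v : HeightOneSpectrum (𝓞 K), v ∉ S ∧ ∃ 𝔓 ∈ v.primesAbove,
      ∃ σ : absoluteGaloisGroup K, IsArithFrobAt (𝓞 K) σ 𝔓 ∧
        ∃ i : ℕ, 1 ≤ Valued.v ((FramedRep.charpoly ρ σ - arithFrobPolyOfSatake ι v.residueCard 1 (α j v)).coeff i) := by
    intro j
    have h := j.2
    simp only [IsNear] at h
    push Not at h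
    exact h
  choose v hvS 𝔓 h𝔓 σ hσ i hi using H
  -- the given Frobenius choice has, at the bad places, the bad characteristic polynomials (ρ unramified off S)
  choose 𝔔 h𝔔 hΦ' using hΦ
  have hceq : ∀ j, FramedRep.charpoly ρ (Φ (v j)) = FramedRep.charpoly ρ (σ j) := fun j =>
    (FramedGaloisRep.IsUnramifiedAt.hasFrobCharpolyAt_charpoly (hur _ (hvS j)) (h𝔓 j) (hσ j)) (𝔔 (v j) (hvS j)) (h𝔔 (v j) (hvS j))
      (Φ (v j)) (hΦ' (v j) (hvS j))
  -- variable, Satake coefficient and Galois coefficient of the far member at its bad datum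
  let X : {j : Fin k // ¬ IsNear ι ρ S (α j)} → {w : HeightOneSpectrum (𝓞 K) // w ∉ S} × ℕ := fun j => (⟨v j, hvS j⟩, i j)
  let a : {j : Fin k // ¬ IsNear ι ρ S (α j)} → PadicAlgCl ℓ := fun j => (arithFrobPolyOfSatake ι (v j).residueCard 1 (α j (v j))).coeff (i j)
  let c : {j : Fin k // ¬ IsNear ι ρ S (α j)} → PadicAlgCl ℓ := fun j => (FramedRep.charpoly ρ (σ j)).coeff (i j)
  have hc1 : ∀ j, Valued.v (c j) ≤ 1 := fun j => valuation_coeff_charpoly_le_one ρ _ _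
  have hca : ∀ j, 1 ≤ Valued.v (c j - a j) := fun j => by simpa only [Polynomial.coeff_sub] using hi j
  -- the scaling `b j ∈ 𝒪` with `b j * a j ∈ 𝒪` and `|b j (c j − a j)| ≥ 1`
  have hb : ∀ j, ∃ b : PadicAlgCl ℓ, Valued.v b ≤ 1 ∧ Valued.v (b * a j) ≤ 1 ∧ 1 ≤ Valued.v (b * (c j - a j)) := by
    intro j
    by_cases ha : Valued.v (a j) ≤ 1
    · exact ⟨1, by simp, by simpa using ha, by simpa using hca j⟩
    · push Not at ha
      have ha0 : a j ≠ 0 := fun h => by simp [h] at ha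
      have hva0 : Valued.v (a j) ≠ 0 := (Valuation.ne_zero_iff _).mpr ha0
      refine ⟨(a j)⁻¹, ?_, ?_, ?_⟩
      · rw [map_inv₀]; exact inv_le_one_of_one_le₀ ha.le
      · rw [inv_mul_cancel₀ ha0, map_one]
      · have hlt : Valued.v (c j) < Valued.v (a j) := (hc1 j).trans_lt ha
        rw [map_mul, map_inv₀, Valuation.map_sub_swap, Valuation.map_sub_eq_of_lt_left _ hlt, inv_mul_cancel₀ hva0]
  choose b hb1 hba hbs using hb
  -- the killing factors `E j = (b j) T_{X j} − (b j a j) ∈ 𝒪[T]`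
  let B : {j : Fin k // ¬ IsNear ι ρ S (α j)} → intRing ℓ := fun j => ⟨b j, (Valuation.mem_valuationSubring_iff _ _).mpr (hb1 j)⟩
  let D : {j : Fin k // ¬ IsNear ι ρ S (α j)} → intRing ℓ := fun j => ⟨b j * a j, (Valuation.mem_valuationSubring_iff _ _).mpr (hba j)⟩
  let E : {j : Fin k // ¬ IsNear ι ρ S (α j)} → MvPolynomial ({w : HeightOneSpectrum (𝓞 K) // w ∉ S} × ℕ) (intRing ℓ) := fun j =>
    MvPolynomial.C (B j) * MvPolynomial.X (X j) - MvPolynomial.C (D j)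
  -- `P' * ∏ E j` is a relation of the WHOLE family
  have hPmem : ∀ j₀ : Fin k, MvPolynomial.eval₂ (intRing ℓ).subtype
      (fun x : {w : HeightOneSpectrum (𝓞 K) // w ∉ S} × ℕ => (arithFrobPolyOfSatake ι x.1.1.residueCard 1 (α j₀ x.1.1)).coeff x.2)
        (P' * ∏ j, E j) = 0 := by
    intro j₀
    rw [← MvPolynomial.coe_eval₂Hom, map_mul, map_prod]
    by_cases hj₀ : IsNear ι ρ S (α j₀)
    · obtain ⟨j', hj'⟩ := hsurj j₀ hj₀
      have h0 := hP' j'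
      simp only [hj'] at h0
      rw [MvPolynomial.coe_eval₂Hom, h0, zero_mul]
    · refine mul_eq_zero_of_right _ (Finset.prod_eq_zero (Finset.mem_univ ⟨j₀, hj₀⟩) ?_)
      simp only [E, map_sub, map_mul, MvPolynomial.eval₂Hom_C, MvPolynomial.eval₂Hom_X']
      exact sub_self (b ⟨j₀, hj₀⟩ * a ⟨j₀, hj₀⟩)
  have hweak := hw.2 Φ (fun w hw' => ⟨𝔔 w hw', h𝔔 w hw', hΦ' w hw'⟩) (P' * ∏ j, E j) hPmem
  -- evaluate at ρ: the far factors are ≥ 1 in absolute value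
  have hev : MvPolynomial.eval₂ (intRing ℓ).subtype
      (fun x : {w : HeightOneSpectrum (𝓞 K) // w ∉ S} × ℕ => (FramedRep.charpoly ρ (Φ x.1.1)).coeff x.2) (P' * ∏ j, E j) =
        MvPolynomial.eval₂ (intRing ℓ).subtype
          (fun x : {w : HeightOneSpectrum (𝓞 K) // w ∉ S} × ℕ => (FramedRep.charpoly ρ (Φ x.1.1)).coeff x.2) P' *
          ∏ j, b j * (c j - a j) := by
    rw [← MvPolynomial.coe_eval₂Hom, map_mul, map_prod]
    congr 1
    refine Finset.prod_congr rfl fun j _ => ?_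
    simp only [E, map_sub, map_mul, MvPolynomial.eval₂Hom_C, MvPolynomial.eval₂Hom_X']
    show b j * (FramedRep.charpoly ρ (Φ (v j))).coeff (i j) - b j * a j = b j * (c j - a j)
    rw [hceq j, mul_sub]
  rw [hev, map_mul, map_prod] at hweak
  have hge : (1 : NNReal) ≤ ∏ j, Valued.v (b j * (c j - a j)) := Finset.one_le_prod' fun j _ => hbs j
  exact (le_mul_of_one_le_right' hge).trans_lt hweak

/-- C_w ⟹ C_w^iso for an a.e.-unramified `ρ` (localise off `S ∪ Ram ρ`; tree `weakApproximant_mono`). -/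
theorem isoWeakly_of_weakly (hur : ∀ᶠ v : HeightOneSpectrum (𝓞 K) in cofinite, ρ.IsUnramifiedAt v) (h : IsWeaklyProAutomorphic hcpt ι ρ) :
    IsIsotypicallyWeaklyProAutomorphic hcpt ι ρ := by
  obtain ⟨S, hS, h⟩ := h
  let S' : Set (HeightOneSpectrum (𝓞 K)) := S ∪ {v | ¬ ρ.IsUnramifiedAt v}
  have hur' : ∀ v : HeightOneSpectrum (𝓞 K), v ∉ S' → ρ.IsUnramifiedAt v := fun v hv => by
    by_contra h'
    exact hv (Or.inr h')
  refine ⟨S', hS.union (Filter.eventually_cofinite.mp hur), fun r hr => ?_⟩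
  obtain ⟨k, π, α, hw⟩ := h r hr
  obtain ⟨k', π', α', hiso, -⟩ := localise (weakApproximant_mono hw Set.subset_union_left) hur'
  exact ⟨k', π', α', hiso⟩

/-- C_w^iso ⟹ C_w (forget isotypy). -/
theorem weakly_of_isoWeakly (h : IsIsotypicallyWeaklyProAutomorphic hcpt ι ρ) : IsWeaklyProAutomorphic hcpt ι ρ := by
  obtain ⟨S, hS, h⟩ := h
  exact ⟨S, hS, fun r hr => by obtain ⟨k, π, α, hw, -⟩ := h r hr; exact ⟨k, π, α, hw⟩⟩

/-- THE DICTIONARY ENTRY as an iff: C_w ⟺ C_w^iso (a.e.-unramified `ρ`). -/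
theorem weakly_iff_isoWeakly (hur : ∀ᶠ v : HeightOneSpectrum (𝓞 K) in cofinite, ρ.IsUnramifiedAt v) :
    IsWeaklyProAutomorphic hcpt ι ρ ↔ IsIsotypicallyWeaklyProAutomorphic hcpt ι ρ :=
  ⟨isoWeakly_of_weakly hur, weakly_of_isoWeakly⟩

/-- C_w^iso ⟹ H1: the radius-`1` family is a weak `1`-approximant, so ONE member is residually congruent to `ρ` a.e. (tree
`residual_iff_weaklyResidual`, the exchange at `r = s = 1`) — H1 is REDUNDANT in the iso language. -/
theorem residual_of_isoWeakly (hur : ∀ᶠ v : HeightOneSpectrum (𝓞 K) in cofinite, ρ.IsUnramifiedAt v)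
    (h : IsIsotypicallyWeaklyProAutomorphic hcpt ι ρ) : IsResiduallyAutomorphic hcpt ι ρ := by
  obtain ⟨S, hS, h⟩ := h
  obtain ⟨k, π, α, hw, -⟩ := h 1 one_pos
  exact (residual_iff_weaklyResidual hur).mpr ⟨S, hS, k, π, α, hw⟩

/-- an isotypic approximant at radius `r ≤ 1` is never empty (the constant relation `1` would have to be `r`-small at `ρ`). -/
theorem isotypicApproximant_pos {S : Set (HeightOneSpectrum (𝓞 K))} {r : NNReal} (hr1 : r ≤ 1) {k : ℕ}
    {π : Fin k → CuspidalAutomorphicRepData n K hcpt} {α : Fin k → HeightOneSpectrum (𝓞 K) → Multiset ℂ}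
    (h : IsIsotypicApproximant hcpt ι ρ S r k π α) : 0 < k := by
  classical
  by_contra hk
  have hk0 : k = 0 := by omega
  subst hk0
  choose Φ 𝔔 h𝔔 hΦ using fun w : HeightOneSpectrum (𝓞 K) => exists_frob (K := K) w
  have key := h.1.2 Φ (fun w _ => ⟨𝔔 w, h𝔔 w, hΦ w⟩) 1 fun j => Fin.elim0 j
  rw [← MvPolynomial.coe_eval₂Hom, map_one, map_one] at key
  exact absurd (hr1.trans_lt key) (lt_irrefl _)

/-- crystalline above ℓ ⟹ semistable above ℓ (same clauses, `N = 0` dropped). -/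
theorem isSemistableAbove_of_isCrystallineAbove (h : IsCrystallineAbove ρ) : IsSemistableAbove ρ := fun v hv => by
  obtain ⟨hdR, r, hWD, -, hunr⟩ := h v hv
  exact ⟨hdR, r, hWD, hunr⟩

end Kernel

/-! ## 35. The EQUIV: SST ⟺ ISST (modulo NOTHING) -/

/-- SST ⟹ ISST: C_w^iso supplies both H1 (`residual_of_isoWeakly`) and C_w (`weakly_of_isoWeakly`). -/
theorem isoSst_of_sst (h : SemistableRankBound) : IsotypicSemistableRank :=
  fun K _ _ n hcpt hn ℓ _ ι ρ hirr hgeo hss hiso =>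
    h K n hcpt hn ℓ ι ρ hirr hgeo hss (residual_of_isoWeakly hgeo.1 hiso) (weakly_of_isoWeakly hiso)

/-- ISST ⟹ SST: LOCALISE the given weak approximants (`isoWeakly_of_weakly`); H1 is not even used. -/
theorem sst_of_isoSst (h : IsotypicSemistableRank) : SemistableRankBound :=
  fun K _ _ n hcpt hn ℓ _ ι ρ hirr hgeo hss _h1 hw => h K n hcpt hn ℓ ι ρ hirr hgeo hss (isoWeakly_of_weakly hgeo.1 hw)

/-- THE EQUIV of the node: SST ⟺ ISST. -/
theorem sst_iff_isoSst : SemistableRankBound ↔ IsotypicSemistableRank :=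
  ⟨isoSst_of_sst, sst_of_isoSst⟩

/-! ## 36. The split beneath the EQUIV: ISST ⟺ CRYS ∧ MONO (exact dial on the monodromy at v ∣ ℓ) -/

/-- ISST ⟹ CRYS (crystalline ⟹ semistable). -/
theorem crys_of_isoSst (h : IsotypicSemistableRank) : CrystallineIsotypicRank :=
  fun K _ _ n hcpt hn ℓ _ ι ρ hirr hgeo hcr hiso => h K n hcpt hn ℓ ι ρ hirr hgeo (isSemistableAbove_of_isCrystallineAbove hcr) hiso

/-- ISST ⟹ MONO (drop the non-crystalline hypothesis). -/
theorem mono_of_isoSst (h : IsotypicSemistableRank) : MonodromicIsotypicRank :=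
  fun K _ _ n hcpt hn ℓ _ ι ρ hirr hgeo hss _hncr hiso => h K n hcpt hn ℓ ι ρ hirr hgeo hss hiso

/-- CRYS ∧ MONO ⟹ ISST (both binders used: the dial «is ρ crystalline above ℓ?»). -/
theorem isoSst_of_cells (h₁ : CrystallineIsotypicRank) (h₂ : MonodromicIsotypicRank) : IsotypicSemistableRank :=
  fun K _ _ n hcpt hn ℓ _ ι ρ hirr hgeo hss hiso => by
    by_cases hcr : IsCrystallineAbove ρ
    · exact h₁ K n hcpt hn ℓ ι ρ hirr hgeo hcr hiso
    · exact h₂ K n hcpt hn ℓ ι ρ hirr hgeo hss hcr hiso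

/-- the split is EXACT: ISST ⟺ CRYS ∧ MONO. -/
theorem isoSst_iff_cells : IsotypicSemistableRank ↔ CrystallineIsotypicRank ∧ MonodromicIsotypicRank :=
  ⟨fun h => ⟨crys_of_isoSst h, mono_of_isoSst h⟩, fun h => isoSst_of_cells h.1 h.2⟩

/-- SST ⟹ CRYS. -/
theorem crys_of_sst (h : SemistableRankBound) : CrystallineIsotypicRank :=
  crys_of_isoSst (isoSst_of_sst h)

/-- SST ⟹ MONO. -/
theorem mono_of_sst (h : SemistableRankBound) : MonodromicIsotypicRank :=
  mono_of_isoSst (isoSst_of_sst h)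

/-- at the TARGET by name: SST ⟺ CRYS ∧ MONO (EQUIV ∘ split, modulo NOTHING). -/
theorem sst_iff_cells : SemistableRankBound ↔ CrystallineIsotypicRank ∧ MonodromicIsotypicRank := by
  rw [sst_iff_isoSst, isoSst_iff_cells]

/-- lineage exactness one level up (by name): RANK ⟺ CRYS ∧ MONO ∧ TRANSIT. -/
theorem rankBound_iff_three : FernRankBound ↔ CrystallineIsotypicRank ∧ MonodromicIsotypicRank ∧ SolvableTransit := by
  rw [rankBound_iff_sst_and_transit, sst_iff_cells, and_assoc]

/-- and at FERN (stmt-Langlands-25024, by name): FERN ⟺ HF ∧ CRYS ∧ MONO ∧ TRANSIT — no EXCESS anywhere in the chain. -/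
theorem fernSpread_iff_four :
    DepthPrimeSplit.FernSpread ↔ HeckeFern ∧ CrystallineIsotypicRank ∧ MonodromicIsotypicRank ∧ SolvableTransit := by
  rw [fernSpread_iff_three, sst_iff_cells, and_assoc]

/-! ## 37. Root-implication of every piece (no piece can be vacuously strong) -/

/-- the summit gives CRYS ∧ MONO (through the tree's `rankBound_of_langlands` and the EQUIV). -/
theorem cells_of_langlands (hL : _root_.Langlands) : CrystallineIsotypicRank ∧ MonodromicIsotypicRank :=
  sst_iff_cells.mp (sst_of_rankBound (rankBound_of_langlands hL))

/-- FERN gives CRYS ∧ MONO. -/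
theorem cells_of_fernSpread (hF : DepthPrimeSplit.FernSpread) : CrystallineIsotypicRank ∧ MonodromicIsotypicRank :=
  sst_iff_cells.mp (sst_of_rankBound (rankBound_of_fernSpread hF))

/-! ## 38. Frames (deciding-theorem shapes, every binder consumed, targets BY NAME) -/

/-- SST frame: CRYS → MONO → SST (the tree decl `FernTransit.SemistableRankBound`). -/
theorem closes_sst (h₁ : CrystallineIsotypicRank) (h₂ : MonodromicIsotypicRank) : SemistableRankBound :=
  sst_of_isoSst (isoSst_of_cells h₁ h₂)

/-- RANK frame: CRYS → MONO → TRANSIT → RANK, through the tree's `FernTransit.closes_residual`. -/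
theorem closes_rank (h₁ : CrystallineIsotypicRank) (h₂ : MonodromicIsotypicRank) (hT : SolvableTransit) : FernRankBound :=
  FernTransit.closes_residual (closes_sst h₁ h₂) hT

/-- FERN frame (a child route's `closes` shape on stmt-Langlands-25024): HF → CRYS → MONO → TRANSIT → FERN, through the tree's
`FernTransit.closes_target`. -/
theorem closes_target (hH : HeckeFern) (h₁ : CrystallineIsotypicRank) (h₂ : MonodromicIsotypicRank) (hT : SolvableTransit) :
    DepthPrimeSplit.FernSpread :=
  FernTransit.closes_target hH (closes_sst h₁ h₂) hT

/-- root frame: `FernTransit.closes_root` with SST replaced by CRYS, MONO (eleven binders → the summit; CLASS etc. by name). -/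
theorem closes_root (hD : DepthPrimeSplit.DyadicSeed) (hO : DepthPrimeSplit.OddPrimeSeed) (hH : HeckeFern)
    (h₁ : CrystallineIsotypicRank) (h₂ : MonodromicIsotypicRank) (hT : SolvableTransit) (hC : DepthPrimeSplit.Classicality)
    (hW : DepthPrimeSplit.SatakeAvatarExistence) (hP : DepthPrimeSplit.PadicMemberCompatibility)
    (hA : DepthPrimeSplit.CompatibilityAwayFromLR) (hR : DepthPrimeSplit.CanonicalReciprocityData) : _root_.Langlands :=
  FernTransit.closes_root hD hO hH (closes_sst h₁ h₂) hT hC hW hP hA hR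

end Summit.Langlands.Langlands.Theorems.FernIsotypic
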